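import Mathlib
import Summits.HubbardSuperconductivity.HubbardSuperconductivity.Theorems.BalabanIRBirGappedPhaseReductionRBlockLondonSymbol

/-!
# Route BalabanIR — crux 4R `BirGappedPhaseReductionR` (item `stmt-HubbardSuperconductivity-14846`):
# block-London coercivity X — a gap lower bound LINEAR in the pairing amplitudes, and the
# block symbol versus the minimal momentum representative

Two inputs of the assembly of the kernel symbol inequality from (K1) + (K2):
* `uniform_gap_linear`: for `μ ∈ (-4,4)` there is `κ(μ) > 0` with
  `E(p) ≥ κ · min(|Δ₁|, |Δ₂|)` for all momenta in `[0,2π]²` whenever `min(|Δ₁|,|Δ₂|) ≤ 1`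
  (compactness: `max(ξ², 4(cos p₀-cos p₁)² + 16 sin²p₀ sin²p₁)` is continuous and positive, and
  `|Δ(p)|² = 4Δ₁²(cos p₀-cos p₁)² + 16Δ₂² sin²p₀ sin²p₁`);
* `blockSymbol_le_sq`: `ℓ⁻²(|1-χ_q(ℓe₀)|² + |1-χ_q(ℓe₁)|²) ≤ v₀² + v₁²` for every representative
  `v ≡ 2πq/L (mod 2π)`, and `blockSymbol_le_eight`: `… ≤ 8/ℓ²`;
* `abs_sub_int_mul_ge_minRep`: `|p - 2πn| ≥ min(p, 2π - p)` for `p ∈ [0,2π)`, `n ∈ ℤ`.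
No definition is introduced.
-/

noncomputable section

namespace Summit.HubbardSuperconductivity.HubbardSuperconductivity.Theorems

namespace BirBdG

open Literature.Probability.LatticeModels

/-! ### The linear gap bound -/

/-- `|Δ(p)|² = 4Δ₁²(cos p₀ - cos p₁)² + 16 Δ₂² sin²p₀ sin²p₁`. [folklore] -/
theorem normSq_pairingSymbol (Δ₁ Δ₂ p₀ p₁ : ℝ) :
    ‖((2 * Δ₁ * (Real.cos p₀ - Real.cos p₁) : ℝ) : ℂ) -
        4 * Complex.I * ((Δ₂ * Real.sin p₀ * Real.sin p₁ : ℝ) : ℂ)‖ ^ 2 =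
      4 * Δ₁ ^ 2 * (Real.cos p₀ - Real.cos p₁) ^ 2 + 16 * Δ₂ ^ 2 * (Real.sin p₀ * Real.sin p₁) ^ 2 := by
  have e : ((2 * Δ₁ * (Real.cos p₀ - Real.cos p₁) : ℝ) : ℂ) -
      4 * Complex.I * ((Δ₂ * Real.sin p₀ * Real.sin p₁ : ℝ) : ℂ) =
      ((2 * Δ₁ * (Real.cos p₀ - Real.cos p₁) : ℝ) : ℂ) +
        ((-(4 * (Δ₂ * Real.sin p₀ * Real.sin p₁)) : ℝ) : ℂ) * Complex.I := by
    push_cast; ring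
  rw [e, ← Complex.normSq_eq_norm_sq, Complex.normSq_add_mul_I]
  ring

/-- **The BdG gap is bounded below linearly in `min(|Δ₁|,|Δ₂|)`, uniformly in the gap.** For
`μ ∈ (-4,4)` there is `κ > 0` such that for all `Δ₁, Δ₂` with `min(|Δ₁|,|Δ₂|) ≤ 1` and all
`p₀, p₁ ∈ [0,2π]`, `κ · min(|Δ₁|,|Δ₂|) ≤ E(p)`. [folklore] -/
theorem uniform_gap_linear : ∀ (μ : ℝ), μ ∈ Set.Ioo (-4 : ℝ) 4 → ∃ κ : ℝ, 0 < κ ∧ ∀ (Δ₁ Δ₂ p₀ p₁ : ℝ), min |Δ₁| |Δ₂| ≤ 1 → p₀ ∈ Set.Icc 0 (2 * Real.pi) → p₁ ∈ Set.Icc 0 (2 * Real.pi) → κ * min |Δ₁| |Δ₂| ≤ Real.sqrt ((-2 * Real.cos p₀ - 2 * Real.cos p₁ - μ) ^ 2 + ‖((2 * Δ₁ * (Real.cos p₀ - Real.cos p₁) : ℝ) : ℂ) - 4 * Complex.I * ((Δ₂ * Real.sin p₀ * Real.sin p₁ : ℝ) : ℂ)‖ ^ 2) := by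
  intro μ hμ
  -- the gap-free comparison function
  set h : ℝ × ℝ → ℝ := fun p => max ((-2 * Real.cos p.1 - 2 * Real.cos p.2 - μ) ^ 2)
    (4 * (Real.cos p.1 - Real.cos p.2) ^ 2 + 16 * (Real.sin p.1 * Real.sin p.2) ^ 2) with hh
  have hcont : Continuous h := by rw [hh]; fun_prop
  have hpos : ∀ p, 0 < h p := by
    intro p
    rw [hh]
    simp only
    by_contra hle
    push Not at hle
    have h1 : (-2 * Real.cos p.1 - 2 * Real.cos p.2 - μ) ^ 2 ≤ 0 := le_trans (le_max_left _ _) hle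
    have h2 : 4 * (Real.cos p.1 - Real.cos p.2) ^ 2 + 16 * (Real.sin p.1 * Real.sin p.2) ^ 2 ≤ 0 :=
      le_trans (le_max_right _ _) hle
    have hξ : -2 * Real.cos p.1 - 2 * Real.cos p.2 - μ = 0 := by nlinarith [sq_nonneg (-2 * Real.cos p.1 - 2 * Real.cos p.2 - μ)]
    have hc : Real.cos p.1 - Real.cos p.2 = 0 := by
      nlinarith [sq_nonneg (Real.cos p.1 - Real.cos p.2), sq_nonneg (Real.sin p.1 * Real.sin p.2)]
    have hs : Real.sin p.1 * Real.sin p.2 = 0 := by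
      nlinarith [sq_nonneg (Real.cos p.1 - Real.cos p.2), sq_nonneg (Real.sin p.1 * Real.sin p.2)]
    -- `cos p₀ = cos p₁ = ±1`, contradicting `μ ∈ (-4,4)`
    have hcc : (Real.cos p.1 = 1 ∧ Real.cos p.2 = 1) ∨ (Real.cos p.1 = -1 ∧ Real.cos p.2 = -1) := by
      have hcos : Real.cos p.1 = Real.cos p.2 := by linarith
      rcases mul_eq_zero.1 hs with h | h
      · rcases Real.sin_eq_zero_iff_cos_eq.1 h with hc | hc
        · exact Or.inl ⟨hc, hcos ▸ hc⟩
        · exact Or.inr ⟨hc, hcos ▸ hc⟩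
      · rcases Real.sin_eq_zero_iff_cos_eq.1 h with hc | hc
        · exact Or.inl ⟨hcos.trans hc, hc⟩
        · exact Or.inr ⟨hcos.trans hc, hc⟩
    rcases hcc with ⟨c0, c1⟩ | ⟨c0, c1⟩
    · rw [c0, c1] at hξ; linarith [hμ.1, hμ.2]
    · rw [c0, c1] at hξ; linarith [hμ.1, hμ.2]
  have hK : IsCompact (Set.Icc (0 : ℝ) (2 * Real.pi) ×ˢ Set.Icc (0 : ℝ) (2 * Real.pi)) :=
    isCompact_Icc.prod isCompact_Icc
  have hne : (Set.Icc (0 : ℝ) (2 * Real.pi) ×ˢ Set.Icc (0 : ℝ) (2 * Real.pi)).Nonempty :=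
    ⟨(0, 0), ⟨⟨le_rfl, by positivity⟩, ⟨le_rfl, by positivity⟩⟩⟩
  obtain ⟨p, _, hmin⟩ := hK.exists_isMinOn hne hcont.continuousOn
  have h0 : 0 < h p := hpos p
  refine ⟨Real.sqrt (h p), Real.sqrt_pos.2 h0, fun Δ₁ Δ₂ p₀ p₁ hm hp₀ hp₁ => ?_⟩
  have hle : h p ≤ h (p₀, p₁) := hmin (Set.mk_mem_prod hp₀ hp₁)
  set mΔ : ℝ := min |Δ₁| |Δ₂| with hmΔ
  have hmΔ0 : 0 ≤ mΔ := le_min (abs_nonneg _) (abs_nonneg _)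
  -- `(κ mΔ)² ≤ E²`
  rw [show Real.sqrt (h p) * mΔ = Real.sqrt (h p * mΔ ^ 2) by
    rw [Real.sqrt_mul h0.le, Real.sqrt_sq hmΔ0]]
  apply Real.sqrt_le_sqrt
  rw [normSq_pairingSymbol]
  have hm1 : mΔ ^ 2 ≤ 1 := by nlinarith
  have hmΔ1 : mΔ ^ 2 ≤ Δ₁ ^ 2 := by
    have : mΔ ≤ |Δ₁| := min_le_left _ _
    have := pow_le_pow_left₀ hmΔ0 this 2
    rwa [sq_abs] at this
  have hmΔ2 : mΔ ^ 2 ≤ Δ₂ ^ 2 := by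
    have : mΔ ≤ |Δ₂| := min_le_right _ _
    have := pow_le_pow_left₀ hmΔ0 this 2
    rwa [sq_abs] at this
  rw [hh] at hle
  simp only at hle
  rcases le_max_iff.1 hle with hx | hx
  · -- `h p ≤ ξ²`: then `h p · mΔ² ≤ ξ² ≤ E²`
    have hA : h p * mΔ ^ 2 ≤ (-2 * Real.cos p₀ - 2 * Real.cos p₁ - μ) ^ 2 * 1 :=
      mul_le_mul hx hm1 (sq_nonneg _) (sq_nonneg _)
    nlinarith [sq_nonneg (Real.cos p₀ - Real.cos p₁), sq_nonneg (Real.sin p₀ * Real.sin p₁),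
      sq_nonneg Δ₁, sq_nonneg Δ₂]
  · -- `h p ≤ gg`: then `h p · mΔ² ≤ gg · mΔ² ≤ |Δ|²`
    have hA : h p * mΔ ^ 2 ≤
        (4 * (Real.cos p₀ - Real.cos p₁) ^ 2 + 16 * (Real.sin p₀ * Real.sin p₁) ^ 2) * mΔ ^ 2 :=
      mul_le_mul_of_nonneg_right hx (sq_nonneg _)
    have hB : (4 * (Real.cos p₀ - Real.cos p₁) ^ 2 + 16 * (Real.sin p₀ * Real.sin p₁) ^ 2) * mΔ ^ 2 ≤
        4 * Δ₁ ^ 2 * (Real.cos p₀ - Real.cos p₁) ^ 2 + 16 * Δ₂ ^ 2 * (Real.sin p₀ * Real.sin p₁) ^ 2 := by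
      have h1 := mul_le_mul_of_nonneg_left hmΔ1 (by positivity : (0 : ℝ) ≤ 4 * (Real.cos p₀ - Real.cos p₁) ^ 2)
      have h2 := mul_le_mul_of_nonneg_left hmΔ2 (by positivity : (0 : ℝ) ≤ 16 * (Real.sin p₀ * Real.sin p₁) ^ 2)
      nlinarith
    nlinarith [sq_nonneg (-2 * Real.cos p₀ - 2 * Real.cos p₁ - μ)]

/-! ### The block symbol and the minimal representative of a lattice momentum -/

/-- `|p - 2πn| ≥ min(p, 2π - p)` for `0 ≤ p < 2π` and every integer `n`. [folklore] -/
theorem abs_sub_int_mul_ge_minRep {p : ℝ} (hp0 : 0 ≤ p) (hp1 : p < 2 * Real.pi) (n : ℤ) :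
    min p (2 * Real.pi - p) ≤ |p - 2 * Real.pi * n| := by
  rcases le_or_gt n 0 with h | h
  · have hn : (n : ℝ) ≤ 0 := by exact_mod_cast h
    have : p ≤ p - 2 * Real.pi * n := by nlinarith [Real.pi_pos]
    exact (min_le_left _ _).trans (this.trans (le_abs_self _))
  · have hn : (1 : ℝ) ≤ n := by exact_mod_cast h
    have : 2 * Real.pi - p ≤ -(p - 2 * Real.pi * n) := by nlinarith [Real.pi_pos]
    exact (min_le_right _ _).trans (this.trans (neg_le_abs _))

variable {L : ℕ} [NeZero L]

/-- The character value along a block shift: `Re χ_q(ℓ e₀) = cos(ℓ · 2πq₀/L)` (and `e₁`). [folklore] -/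
theorem torusChar_blockShift_re (q : TorusSite 2 L) (ℓ : ℕ) :
    (torusChar q (![((ℓ : ℕ) : ZMod L), 0] : TorusSite 2 L)).re =
        Real.cos (ℓ * latticeMomentum L q 0) ∧
      (torusChar q (![0, ((ℓ : ℕ) : ZMod L)] : TorusSite 2 L)).re =
        Real.cos (ℓ * latticeMomentum L q 1) := by
  have hL : (L : ℝ) ≠ 0 := by exact_mod_cast NeZero.ne L
  -- `cos (p · (ℓ mod L)) = cos (p ℓ)` for `p = 2πk/L`
  have key : ∀ i : Fin 2, Real.cos (latticeMomentum L q i * ((((ℓ : ℕ) : ZMod L)).val : ℝ)) =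
      Real.cos (ℓ * latticeMomentum L q i) := by
    intro i
    rw [ZMod.val_natCast]
    have hmod : ((ℓ % L : ℕ) : ℝ) = (ℓ : ℝ) - (L : ℝ) * ((ℓ / L : ℕ) : ℝ) := by
      have := Nat.mod_add_div ℓ L
      have h' : ((ℓ % L : ℕ) : ℝ) + (L : ℝ) * ((ℓ / L : ℕ) : ℝ) = ℓ := by exact_mod_cast this
      linarith
    rw [hmod]
    unfold latticeMomentum
    have e : 2 * Real.pi * ((q i).val : ℝ) / L * ((ℓ : ℝ) - (L : ℝ) * ((ℓ / L : ℕ) : ℝ)) =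
        (ℓ : ℝ) * (2 * Real.pi * ((q i).val : ℝ) / L) -
          (((q i).val * (ℓ / L) : ℕ) : ℝ) * (2 * Real.pi) := by
      rw [Nat.cast_mul]; field_simp
    rw [e, Real.cos_sub_nat_mul_two_pi]
  constructor
  · rw [torusChar_re]
    simp only [Fin.sum_univ_two, Matrix.cons_val_zero, Matrix.cons_val_one, Matrix.cons_val_fin_one,
      ZMod.val_zero, Nat.cast_zero, mul_zero, add_zero]
    exact key 0
  · rw [torusChar_re]
    simp only [Fin.sum_univ_two, Matrix.cons_val_zero, Matrix.cons_val_one, Matrix.cons_val_fin_one,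
      ZMod.val_zero, Nat.cast_zero, mul_zero, zero_add]
    exact key 1

/-- `2 - 2cos(ℓ x) ≤ ℓ² y²` whenever `x ≡ y (mod 2π)`: `1 - cos t ≤ t²/2`. [folklore] -/
theorem two_sub_two_cos_le_sq (ℓ : ℕ) {x y : ℝ} (hxy : ∃ n : ℤ, y = x + 2 * Real.pi * n) :
    2 - 2 * Real.cos (ℓ * x) ≤ (ℓ : ℝ) ^ 2 * y ^ 2 := by
  obtain ⟨n, hn⟩ := hxy
  have hc : Real.cos (ℓ * x) = Real.cos (ℓ * y) := by
    rw [hn, mul_add, show (ℓ : ℝ) * (2 * Real.pi * n) = ((ℓ * n : ℤ) : ℝ) * (2 * Real.pi) by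
      push_cast; ring, Real.cos_add_int_mul_two_pi]
  rw [hc]
  have := Real.one_sub_sq_div_two_le_cos (x := ℓ * y)
  nlinarith

/-- **The block symbol is dominated by the squared minimal representative**:
`ℓ⁻²(|1 - χ_q(ℓe₀)|² + |1 - χ_q(ℓe₁)|²) ≤ v₀² + v₁²` for every `v ≡ 2πq/L (mod 2π)`. [folklore] -/
theorem blockSymbol_le_sq (q : TorusSite 2 L) {ℓ : ℕ} (hℓ : 0 < ℓ) (v : Fin 2 → ℝ)
    (hv : ∀ i, ∃ n : ℤ, v i = latticeMomentum L q i + 2 * Real.pi * n) :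
    ((ℓ : ℝ) ^ 2)⁻¹ * (‖1 - torusChar q (![((ℓ : ℕ) : ZMod L), 0] : TorusSite 2 L)‖ ^ 2 +
        ‖1 - torusChar q (![0, ((ℓ : ℕ) : ZMod L)] : TorusSite 2 L)‖ ^ 2) ≤ v 0 ^ 2 + v 1 ^ 2 := by
  have hℓ2 : (0 : ℝ) < (ℓ : ℝ) ^ 2 := by positivity
  rw [normSq_one_sub_torusChar, normSq_one_sub_torusChar, (torusChar_blockShift_re q ℓ).1,
    (torusChar_blockShift_re q ℓ).2, inv_mul_le_iff₀ hℓ2]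
  have h0 := two_sub_two_cos_le_sq ℓ (hv 0)
  have h1 := two_sub_two_cos_le_sq ℓ (hv 1)
  nlinarith

omit [NeZero L] in
/-- `ℓ⁻²(|1 - χ_q(ℓe₀)|² + |1 - χ_q(ℓe₁)|²) ≤ 8/ℓ²`. [folklore] -/
theorem blockSymbol_le_eight [NeZero L] (q : TorusSite 2 L) {ℓ : ℕ} (hℓ : 0 < ℓ) :
    ((ℓ : ℝ) ^ 2)⁻¹ * (‖1 - torusChar q (![((ℓ : ℕ) : ZMod L), 0] : TorusSite 2 L)‖ ^ 2 +
        ‖1 - torusChar q (![0, ((ℓ : ℕ) : ZMod L)] : TorusSite 2 L)‖ ^ 2) ≤ 8 / (ℓ : ℝ) ^ 2 := by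
  have hℓ2 : (0 : ℝ) < (ℓ : ℝ) ^ 2 := by positivity
  rw [div_eq_mul_inv, mul_comm (8 : ℝ)]
  apply mul_le_mul_of_nonneg_left _ (inv_nonneg.2 hℓ2.le)
  have h : ∀ x : TorusSite 2 L, ‖1 - torusChar q x‖ ^ 2 ≤ 4 := fun x => by
    have := norm_sub_le (1 : ℂ) (torusChar q x)
    rw [norm_one, norm_torusChar] at this
    nlinarith [norm_nonneg (1 - torusChar q x)]
  linarith [h ![((ℓ : ℕ) : ZMod L), 0], h ![0, ((ℓ : ℕ) : ZMod L)]]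

end BirBdG

end Summit.HubbardSuperconductivity.HubbardSuperconductivity.Theorems

end
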